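import Summits.ResolutionOfSingularities.ResolutionOfSingularities.Theorems.DescentDescentPerfectToAllSeparableOverFg
import Summits.ResolutionOfSingularities.ResolutionOfSingularities.Theorems.WeightedInvariantDescentPerfectToAllEssFiniteTypeOverPerfect
import Mathlib.FieldTheory.IntermediateField.Adjoin.Algebra

/-!
# `DescentPerfectToAll` (stmt-ResolutionOfSingularities-0549): resolutions ascend along every
# separable extension of the ground field

Route `ResolutionOfSingularities/Descent`, crux `DescentPerfectToAll` ("for a prime `p`, resolution of
all reduced separated schemes of finite type over all PERFECT fields of characteristic `p` implies
resolution over ALL fields of characteristic `p`"). Helper file (OURS; `--supports` the crux, does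
not close it; NOT a statement of any manuscript).

The crux is obstructed exactly by INSEPARABILITY of the ground field over a field of definition
(tree barrier `Literature.Barriers.ResolutionOfSingularities.InseparableBaseChange`: regular is not
geometrically regular). This file proves the complementary positive statement in its natural
generality, with no finite-generation and no algebraicity hypothesis on the extension:

**Theorem (`hasResolution_pullback_of_linearIndepOn_pow`).** Let `k/K` be a field extension of
characteristic exponent `p` which is separable in MacLane's sense — every `K`-linearly independent
finite family of `k` has `K`-linearly independent `p`-th powers — and let `X₀ → Spec K` be of
finite type. If `X₀` has a resolution of singularities, so does `X₀ ×_K k` (namely the base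
change of the resolution).

The regularity statement behind it (`isRegular_pullback_of_linearIndepOn_pow_of_field`: `Y`
regular of finite type over `K` ⇒ `Y ×_K k` regular) is EGA IV₂ 6.7.4 / Stacks 030W for the
finitely generated sub-levels `K(C) ⊆ k` (tree: `isRegular_pullback_of_linearIndepOn_pow`,
separating transcendence bases) combined with REGULARITY OF THE LIMIT over those levels
(`isRegular_pullback_of_fgLevels`, the `K`-relative form of the tree's
`isRegular_pullback_of_finiteLevels`: a prime of the Noetherian ring `B ⊗_K k` is extended from
some `B ⊗_K K(C)`, and regularity ascends along the flat local map with trivial closed fibre).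

**Consequences for the crux** (with its antecedent `PerfectRes p`):
* `hasResolution_of_perfectRes_of_isSeparable_essFiniteType` — resolution over every field `k`
  of characteristic `p` that is separable ALGEBRAIC over a subfield `K` essentially of finite type
  over a perfect field `k₀`. This single class of ground fields contains three of the classes
  proved so far in the tree: `k` essentially of finite type over a perfect field
  (`hasResolution_of_perfectRes_of_essFiniteType`, `K = k`), `k` separable algebraic over a finitely
  generated field (`hasResolution_of_perfectRes_of_isSeparable_fg`, `k₀` the prime field), and
  transcendence degree `≤ 1`; new members: e.g. `𝔽_p(u^{1/p^∞})(t)^{sep}`, or any separable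
  algebraic extension of `𝔽_p(u^{1/p^∞})(t₁, …, tₙ)`.
* `descentPerfectToAll_isSeparable_essFiniteType` — the same in the binder shape of the crux.
* For a FIXED scheme the sharper form is the theorem itself: `X₀ ×_K k` is resolvable as soon as
  `X₀` is and `k/K` is separable (any transcendence degree: every `k` in which a `p`-basis of
  `K` stays `p`-independent). This per-scheme form recovers the fourth tree class (separably
  exhausted fields, `hasResolution_of_perfectRes_of_separablyExhausted`: `k` separable, possibly
  transcendental, over a finitely generated field of definition — e.g. `𝔽_p(t, x₁, x₂, …)`, NOT
  separable algebraic over any subfield essentially of finite type over a perfect field).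

NOT covered (the residual of the crux, unchanged): `k` inseparable over every field of definition
of `X`, e.g. `X` defined over `𝔽_p(t, s) ⊆ 𝔽_p((t))`, `s ∉ 𝔽_p(t)^{alg}` (MacLane: `[k : k^p] = p`).
-/

noncomputable section

set_option linter.dupNamespace false -- mandated namespace of this single-conjunct summit

open CategoryTheory CategoryTheory.Limits AlgebraicGeometry TopologicalSpace TensorProduct
  IsLocalRing
open Literature.AlgebraicGeometry.Resolution

namespace Summit.ResolutionOfSingularities.ResolutionOfSingularities.Theorems

universe u

/-! ## Finitely generated intermediate levels -/

/-- Finitely many elements of `B ⊗_K k` involve only finitely many scalars of `k`: for a finite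
`S ⊆ B ⊗_K k` some finite `C ⊆ k` has every element of `S` a sum of tensors `b ⊗ c`, `c ∈ K(C)`. -/
theorem exists_finset_sum_tmul_mem_adjoin {K k : Type u} [Field K] [Field k] [Algebra K k]
    {B : Type u} [CommRing B] [Algebra K B] (S : Finset (B ⊗[K] k)) :
    ∃ C : Finset k, ∀ g ∈ S, ∃ F : Finset (B × k),
      (∀ i ∈ F, i.2 ∈ IntermediateField.adjoin K (↑C : Set k)) ∧ g = ∑ i ∈ F, i.1 ⊗ₜ[K] i.2 := by
  classical
  choose F hF using fun g : B ⊗[K] k => TensorProduct.exists_finset (R := K) g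
  refine ⟨S.biUnion fun g => (F g).image Prod.snd, fun g hg => ⟨F g, fun i hi => ?_, hF g⟩⟩
  refine IntermediateField.subset_adjoin K _ ?_
  simp only [Finset.coe_biUnion, Finset.mem_coe, Finset.coe_image, Set.mem_iUnion, Set.mem_image]
  exact ⟨g, hg, i, hi, rfl⟩

/-- MacLane separability restricts to intermediate levels: if `K`-linearly independent finite
families of `k` have `K`-linearly independent `p`-th powers, the same holds in every field `E`
with `K → E → k` (`E → k` is injective). [folklore] -/
theorem linearIndepOn_pow_of_tower {K k : Type u} [Field K] [Field k] [Algebra K k]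
    (p : ℕ) (H : ∀ u : Finset k, LinearIndepOn K _root_.id (↑u : Set k) →
      LinearIndepOn K (fun x : k => x ^ p) (↑u : Set k))
    (E : Type u) [Field E] [Algebra K E] [Algebra E k] [IsScalarTower K E k]
    (u : Finset E) (hu : LinearIndepOn K _root_.id (↑u : Set E)) :
    LinearIndepOn K (fun x : E => x ^ p) (↑u : Set E) := by
  classical
  let ψ : E →ₐ[K] k := IsScalarTower.toAlgHom K E k
  have hψ : Function.Injective ψ.toLinearMap := ψ.toRingHom.injective
  have h1 : LinearIndepOn K _root_.id (ψ.toLinearMap '' ↑u) := hu.id_imageₛ hψ.injOn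
  rw [← Finset.coe_image] at h1
  have h2 := H _ h1
  rw [Finset.coe_image] at h2
  have h3 : LinearIndepOn K ((fun x : k => x ^ p) ∘ ψ.toLinearMap) ↑u :=
    h2.comp_of_image hψ.injOn
  have h4 : (fun x : k => x ^ p) ∘ ψ.toLinearMap = ψ.toLinearMap ∘ fun x : E => x ^ p := by
    funext x
    simp
  rw [h4] at h3
  exact h3.of_comp _

/-- A finitely generated intermediate field `K(C)` is essentially of finite type over `K`. [folklore] -/
theorem essFiniteType_adjoin_finset {K k : Type u} [Field K] [Field k] [Algebra K k]
    (C : Finset k) : Algebra.EssFiniteType K (IntermediateField.adjoin K (↑C : Set k)) := by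
  classical
  refine IntermediateField.fg_top_iff.mp
    ⟨C.subtype (· ∈ IntermediateField.adjoin K (↑C : Set k)), ?_⟩
  rw [eq_top_iff]
  intro z _
  -- `K(C) ≤ (image of the adjoined subfield in k)`, a subfield of `k` containing `K` and `C`
  have hle : IntermediateField.adjoin K (↑C : Set k) ≤
      (IntermediateField.adjoin K
        (↑(C.subtype (· ∈ IntermediateField.adjoin K (↑C : Set k))) :
          Set (IntermediateField.adjoin K (↑C : Set k)))).map
        (IntermediateField.adjoin K (↑C : Set k)).val := by
    rw [IntermediateField.adjoin_le_iff]
    intro x hx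
    have hxE : x ∈ IntermediateField.adjoin K (↑C : Set k) := IntermediateField.subset_adjoin K _ hx
    refine ⟨⟨x, hxE⟩, ?_, rfl⟩
    refine IntermediateField.subset_adjoin K _ ?_
    rw [Finset.mem_coe, Finset.mem_subtype]
    exact hx
  obtain ⟨w, hw, hwz⟩ := hle z.2
  have hwz' : w = z := Subtype.ext hwz
  rw [← hwz']
  exact hw

/-! ## Regularity of the limit, relative to an arbitrary ground field `K` -/

/-- **Regularity of `Y ×_K k` from regularity over every finitely generated level.** Let
`q : Y → Spec K` be locally of finite type and `k/K` a field extension. If `Y ×_K E` is regular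
for every intermediate level `K → E → k` essentially of finite type over `K` (it suffices to know
it for the levels `K(C)`, `C ⊆ k` finite, which is how it is used), then `Y ×_K k` is regular: the
local ring at a point is `(B ⊗_K k)_𝔓` for an affine open `Spec B` of `Y`; the finitely generated
prime `𝔓` is extended from `𝔓' = 𝔓 ∩ (B ⊗_K K(C))` for the finitely many scalars `C` in its
generators, and regularity ascends along the flat local map `(B ⊗_K K(C))_{𝔓'} → (B ⊗_K k)_𝔓`
whose closed fibre is a field (Matsumura 23.7 (ii)). [cite: Matsumura1987, Thm. 23.7] -/
theorem isRegular_pullback_of_fgLevels {K k : Type u} [Field K] [Field k] [Algebra K k]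
    {Y : Scheme.{u}} (q : Y ⟶ Spec (.of K)) [LocallyOfFiniteType q]
    (hfin : ∀ (E : Type u) [Field E] [Algebra K E] [Algebra E k] [IsScalarTower K E k],
      Algebra.EssFiniteType K E → Scheme.IsRegular (pullback q (specOfAlgebra K E))) :
    Scheme.IsRegular (pullback q (specOfAlgebra K k)) := by
  classical
  intro y
  -- Step 1: an affine chart `Spec B ↪ Y` at the image of `y`, `B` of finite type over `K`
  obtain ⟨W, hW, hyW, -⟩ := exists_isAffineOpen_mem_and_subset (X := Y)
    (x := pullback.fst q (specOfAlgebra K k) y) (U := ⊤) trivial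
  let iW : Spec Γ(Y, W) ⟶ Y := hW.fromSpec
  let φ₀ : CommRingCat.of K ⟶ Γ(Y, W) := Spec.preimage (iW ≫ q)
  letI : Algebra K Γ(Y, W) := φ₀.hom.toAlgebra
  have hi : iW ≫ q = Spec.map (CommRingCat.ofHom (algebraMap K Γ(Y, W))) := by
    rw [RingHom.algebraMap_toAlgebra, CommRingCat.ofHom_hom, Spec.map_preimage]
  haveI : Algebra.FiniteType K Γ(Y, W) := by
    have h1 : LocallyOfFiniteType (Spec.map (CommRingCat.ofHom (algebraMap K Γ(Y, W)))) := by
      rw [← hi]; infer_instance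
    have h2 := (HasRingHomProperty.Spec_iff (P := @LocallyOfFiniteType)).mp h1
    exact RingHom.finiteType_algebraMap.mp h2
  haveI : IsNoetherianRing (Γ(Y, W) ⊗[K] k) := isNoetherianRing_tensor_of_finiteType k Γ(Y, W)
  -- `y` lies in the chart `Spec (B ⊗_K k)`
  let c := specTensorChart k q iW hi
  have hyrange : y ∈ Set.range c := by
    change y ∈ Set.range (specTensorChart k q iW hi)
    rw [range_specTensorChart, Set.mem_preimage, IsAffineOpen.range_fromSpec]
    exact hyW
  obtain ⟨ζ, hζ⟩ := hyrange
  suffices hreg : IsRegularLocalRing (Localization.AtPrime ζ.asIdeal) by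
    rw [← hζ]
    exact (isRegularLocalRing_stalk_iff_of_isOpenImmersion c ζ).mpr
      ((isRegularLocalRing_stalk_Spec_iff _ ζ).mpr hreg)
  obtain ⟨S, hS⟩ := (IsNoetherian.noetherian ζ.asIdeal : ζ.asIdeal.FG)
  -- Step 2: ascent from any level `E` containing the scalars of the generators of `ζ`
  have key : ∀ (E : Type u) [Field E] [Algebra K E] [Algebra E k] [IsScalarTower K E k],
      (∀ g ∈ S, ∃ F : Finset (Γ(Y, W) × k), (∀ i ∈ F, i.2 ∈ Set.range (algebraMap E k)) ∧
        g = ∑ i ∈ F, i.1 ⊗ₜ[K] i.2) →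
      Scheme.IsRegular (pullback q (specOfAlgebra K E)) →
        IsRegularLocalRing (Localization.AtPrime ζ.asIdeal) := by
    intro E _ _ _ _ hmem hE
    set ι := (Algebra.TensorProduct.lTensor (S := K) Γ(Y, W)
      (IsScalarTower.toAlgHom K E k)).toRingHom with hι
    have hSsub : (↑S : Set (Γ(Y, W) ⊗[K] k)) ⊆ SetLike.coe ((ζ.asIdeal.comap ι).map ι) := by
      intro g hg
      obtain ⟨F, hF, rfl⟩ := hmem g hg
      obtain ⟨x, hx⟩ : ∑ i ∈ F, i.1 ⊗ₜ[K] i.2 ∈ Set.range ι := sum_tmul_mem_range_lTensor F hF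
      rw [← hx]
      refine Ideal.mem_map_of_mem ι ?_
      rw [Ideal.mem_comap, hx, ← hS]
      exact Submodule.subset_span hg
    have hgen : ζ.asIdeal ≤ (ζ.asIdeal.comap ι).map ι :=
      calc ζ.asIdeal = Submodule.span _ ↑S := hS.symm
        _ ≤ _ := Submodule.span_le.mpr hSsub
    refine isRegularLocalRing_localization_of_le_map_comap ζ.asIdeal hgen ?_
    -- the level `E` is regular at `ζ ∩ (B ⊗_K E)`
    let cE := specTensorChart E q iW hi
    let 𝔓' : PrimeSpectrum (Γ(Y, W) ⊗[K] E) := ⟨ζ.asIdeal.comap ι, Ideal.IsPrime.comap ι⟩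
    have h1 : IsRegularLocalRing ((pullback q (specOfAlgebra K E)).presheaf.stalk (cE 𝔓')) :=
      hE (cE 𝔓')
    exact (isRegularLocalRing_stalk_Spec_iff _ 𝔓').mp
      ((isRegularLocalRing_stalk_iff_of_isOpenImmersion cE 𝔓').mp h1)
  -- Step 3: the scalars of the generators lie in a finitely generated level `K(C)`
  obtain ⟨C, hmem⟩ := exists_finset_sum_tmul_mem_adjoin (K := K) (k := k) S
  refine key (IntermediateField.adjoin K (↑C : Set k)) (fun g hg => ?_)
    (hfin _ (essFiniteType_adjoin_finset C))
  obtain ⟨F, hF, hg'⟩ := hmem g hg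
  exact ⟨F, fun i hi => ⟨⟨i.2, hF i hi⟩, rfl⟩, hg'⟩

/-! ## Separable base change of a regular scheme of finite type over a field -/

/-- **Regularity survives every separable extension of the ground field** (EGA IV₂ 6.7.4 for
arbitrary, not necessarily finitely generated or algebraic, extensions). Let `k/K` be a field
extension, `p` the characteristic exponent of `K`, such that `K`-linearly independent finite
families of `k` have `K`-linearly independent `p`-th powers (MacLane separability). If
`q : Y → Spec K` is locally of finite type and `Y` is regular, then `Y ×_K k` is regular: every
finitely generated level `K(C) ⊆ k` is separably generated over `K` (Stacks 030W), so
`Y ×_K K(C)` is regular (tree `isRegular_pullback_of_linearIndepOn_pow`), and regularity passes to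
the limit (`isRegular_pullback_of_fgLevels`). [cite: EGAIV2, Prop. 6.7.4; StacksProject, Tag 030W] -/
theorem isRegular_pullback_of_linearIndepOn_pow_of_field (p : ℕ) (hp : p.Prime) {K k : Type u}
    [Field K] [ExpChar K p] [Field k] [Algebra K k]
    (H : ∀ u : Finset k, LinearIndepOn K _root_.id (↑u : Set k) →
      LinearIndepOn K (fun x : k => x ^ p) (↑u : Set k))
    {Y : Scheme.{u}} (q : Y ⟶ Spec (.of K)) [LocallyOfFiniteType q] (hY : Scheme.IsRegular Y) :
    Scheme.IsRegular (pullback q (specOfAlgebra K k)) := by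
  refine isRegular_pullback_of_fgLevels q fun E _ _ _ _ hE => ?_
  haveI := hE
  exact isRegular_pullback_of_linearIndepOn_pow p hp E (linearIndepOn_pow_of_tower p H E) q hY

/-! ## Resolutions ascend along separable ground-field extensions -/

/-- **A resolution of singularities base-changes to a resolution along every separable extension
of the ground field.** Let `k/K` be a MacLane-separable field extension (`p` the characteristic
exponent of `K`) and `f₀ : X₀ → Spec K` of finite type. If `X₀` has a resolution `π : Y → X₀`, then
`X₀ ×_K k` has one, namely `π ×_K k`: it is proper (base change), birational (flat base change of
a birational morphism between Noetherian schemes, tree `isBirational_of_isPullback_of_flat`), and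
`Y ×_K k` is regular (`isRegular_pullback_of_linearIndepOn_pow_of_field`). No hypothesis of
finite generation, algebraicity or separatedness. [cite: EGAIV2, Prop. 6.7.4] -/
theorem hasResolution_pullback_of_linearIndepOn_pow (p : ℕ) (hp : p.Prime) {K k : Type u}
    [Field K] [ExpChar K p] [Field k] [Algebra K k]
    (H : ∀ u : Finset k, LinearIndepOn K _root_.id (↑u : Set k) →
      LinearIndepOn K (fun x : k => x ^ p) (↑u : Set k))
    {X₀ : Scheme.{u}} (f₀ : X₀ ⟶ Spec (.of K)) [LocallyOfFiniteType f₀] [QuasiCompact f₀]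
    (hres : Scheme.HasResolution X₀) :
    Scheme.HasResolution (pullback f₀ (specOfAlgebra K k)) := by
  obtain ⟨Y, π, hπ⟩ := hres
  haveI := hπ.isProper
  -- `X₀` and `Y` are of finite type over the field `K`, hence Noetherian
  haveI : IsNoetherian X₀ := Scheme.isNoetherian_of_finiteType_over_field f₀
  haveI : IsNoetherian Y := Scheme.isNoetherian_of_finiteType_over_field (π ≫ f₀)
  set ι := specOfAlgebra K k with hιdef
  -- the base change `π'` of `π` along the (flat) projection `X₀ ×_K k → X₀`
  obtain ⟨π', h₁, h₂⟩ : ∃ π' : pullback (π ≫ f₀) ι ⟶ pullback f₀ ι,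
      pullback.fst (π ≫ f₀) ι ≫ π = π' ≫ pullback.fst f₀ ι ∧
        π' ≫ pullback.snd f₀ ι = pullback.snd (π ≫ f₀) ι :=
    ⟨pullback.lift (pullback.fst _ _ ≫ π) (pullback.snd _ _)
      (by rw [Category.assoc, pullback.condition]),
      (pullback.lift_fst _ _ _).symm, pullback.lift_snd _ _ _⟩
  have big := IsPullback.of_hasPullback (π ≫ f₀) ι
  rw [← h₂] at big
  have sq : IsPullback (pullback.fst (π ≫ f₀) ι) π' π (pullback.fst f₀ ι) :=
    IsPullback.of_bot big h₁ (IsPullback.of_hasPullback f₀ ι)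
  haveI : IsProper π' := MorphismProperty.of_isPullback sq ‹IsProper π›
  -- flatness of `Spec k → Spec K` and of its base change
  have hff : (algebraMap K k).FaithfullyFlat := RingHom.faithfullyFlat_algebraMap_iff.mpr inferInstance
  obtain ⟨hflat, -⟩ := (flat_and_surjective_SpecMap_iff (CommRingCat.ofHom (algebraMap K k))).mpr hff
  haveI : Flat ι := hflat
  haveI : Flat (pullback.fst f₀ ι) := MorphismProperty.pullback_fst _ _ ‹Flat ι›
  refine ⟨_, π', ‹_›, isBirational_of_isPullback_of_flat sq hπ.isBirational, ?_⟩
  exact isRegular_pullback_of_linearIndepOn_pow_of_field p hp H (π ≫ f₀) hπ.isRegular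

/-- **Subfield form.** For a subfield `K ⊆ k` over which `k` is MacLane-separable and a
finite-type `f₀ : X₀ → Spec K` with `X₀` resolvable, `X₀ ×_K k` has a resolution of
singularities. [cite: EGAIV2, Prop. 6.7.4] -/
theorem hasResolution_pullback_subtype_of_linearIndepOn_pow (p : ℕ) (hp : p.Prime) {k : Type u}
    [Field k] [ExpChar k p] (K : Subfield k)
    (H : ∀ u : Finset k, LinearIndepOn K _root_.id (↑u : Set k) →
      LinearIndepOn K (fun x : k => x ^ p) (↑u : Set k))
    {X₀ : Scheme.{u}} (f₀ : X₀ ⟶ Spec (.of K)) [LocallyOfFiniteType f₀] [QuasiCompact f₀]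
    (hres : Scheme.HasResolution X₀) :
    Scheme.HasResolution (pullback f₀ (Spec.map (CommRingCat.ofHom K.subtype))) := by
  haveI : ExpChar K p := by
    rcases ‹ExpChar k p› with _ | ⟨hp'⟩
    · haveI : CharZero K := K.subtype.charZero
      exact ExpChar.zero
    · haveI : CharP K p := K.subtype.charP Subtype.val_injective p
      exact ExpChar.prime hp'
  exact hasResolution_pullback_of_linearIndepOn_pow p hp H f₀ hres

/-! ## Consequences for the crux: separable algebraic over essentially-finite-type over perfect -/

/-- For subfields `K ≤ E` of `k`, with `E = K(s)` generated over `K` by a finite set, `E` is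
essentially of finite type over `K`. [folklore] -/
theorem essFiniteType_of_eq_adjoin_toSubfield {k : Type u} [Field k] (K E : Subfield k)
    (s : Finset k) (hE : E = (IntermediateField.adjoin K (↑s : Set k)).toSubfield)
    [Algebra K E] [IsScalarTower K E k] : Algebra.EssFiniteType K E := by
  classical
  have hsE : ∀ x ∈ s, x ∈ E := fun x hx => by
    rw [hE]
    exact IntermediateField.subset_adjoin K _ hx
  refine IntermediateField.fg_top_iff.mp ⟨s.subtype (· ∈ E), ?_⟩
  set G := IntermediateField.adjoin K (↑(s.subtype (· ∈ E)) : Set E) with hG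
  rw [eq_top_iff]
  intro z _
  let ψ : E →ₐ[K] k := IsScalarTower.toAlgHom K E k
  have hψ : ∀ x : E, ψ x = (x : k) := fun _ => rfl
  have hle : (IntermediateField.adjoin K (↑s : Set k)) ≤ G.map ψ := by
    rw [IntermediateField.adjoin_le_iff]
    intro x hx
    refine ⟨⟨x, hsE x hx⟩, ?_, hψ _⟩
    refine IntermediateField.subset_adjoin K _ ?_
    rw [Finset.mem_coe, Finset.mem_subtype]
    exact hx
  have hz : (z : k) ∈ IntermediateField.adjoin K (↑s : Set k) := hE.le z.2
  obtain ⟨w, hw, hwz⟩ := hle hz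
  have hwz' : w = z := Subtype.ext (by rw [← hψ w]; exact hwz)
  rw [← hwz']
  exact hw

/-- **Resolution over perfect fields ⇒ resolution over every field separable algebraic over a
subfield essentially of finite type over a perfect field** (characteristic `p`). Let `k₀` be
perfect, `K ⊆ k` a subfield which is essentially of finite type over `k₀` (a finitely generated
field extension of `k₀`), and `k/K` separable algebraic. Then every reduced separated `k`-scheme of
finite type `X` has a resolution: `X` is defined over a finitely generated `K₀ = closure s`
(`stub_fgModel`); the level `E = K(s) ⊇ K₀` is again essentially of finite type over `k₀`, so
`X₀ ×_{K₀} E` is resolvable (`hasResolution_of_perfectRes_of_essFiniteType`: spreading out over a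
`k₀`-variety and generic fibre), and `k/E` is separable algebraic, so the resolution ascends to
`X₀ ×_{K₀} k ≅ X` (`hasResolution_pullback_of_linearIndepOn_pow`). [cite: EGAIV2, Prop. 6.7.4] -/
theorem hasResolution_of_perfectRes_of_isSeparable_essFiniteType (p : ℕ) [Fact p.Prime]
    (H : ∀ (κ : Type) [Field κ] [CharP κ p] [PerfectField κ] (Z : Scheme.{0}) (h : Z ⟶ Spec (.of κ)),
      IsSeparated h → LocallyOfFiniteType h → QuasiCompact h → IsReduced Z → Scheme.HasResolution Z)
    (k₀ : Type) [Field k₀] [PerfectField k₀] (k : Type) [Field k] [CharP k p] (K : Subfield k)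
    [Algebra k₀ K] (hK : Algebra.EssFiniteType k₀ K) [Algebra.IsSeparable K k]
    (X : Scheme.{0}) (f : X ⟶ Spec (.of k)) [IsSeparated f] [LocallyOfFiniteType f] [QuasiCompact f]
    [IsReduced X] : Scheme.HasResolution X := by
  classical
  -- finitely generated field of definition (`stub_fgModel`)
  obtain ⟨K₀, s, hK₀, X₀, f₀, h₁, h₂, h₃, h₄, ⟨e⟩⟩ := stub_fgModel k X f ‹_› ‹_› ‹_› ‹_›
  haveI := h₁; haveI := h₂; haveI := h₃; haveI := h₄
  haveI : IsReduced (pullback f₀ (Spec.map (CommRingCat.ofHom K₀.subtype))) :=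
    isReduced_of_isOpenImmersion e.inv
  -- the level `E = K(s)`, as a subfield of `k`
  set E : Subfield k := (IntermediateField.adjoin K (↑s : Set k)).toSubfield with hEdef
  have hKE : K ≤ E := fun x hx =>
    (IntermediateField.adjoin K (↑s : Set k)).algebraMap_mem ⟨x, hx⟩
  have hK₀E : K₀ ≤ E := by
    rw [hK₀, Subfield.closure_le]
    exact fun x hx => IntermediateField.subset_adjoin K _ hx
  letI : Algebra K E := (Subfield.inclusion hKE).toAlgebra
  haveI : IsScalarTower K E k := IsScalarTower.of_algebraMap_eq fun _ => rfl
  haveI : Algebra.EssFiniteType K E := essFiniteType_of_eq_adjoin_toSubfield K E s hEdef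
  letI : Algebra k₀ E := ((algebraMap K E).comp (algebraMap k₀ K)).toAlgebra
  haveI : IsScalarTower k₀ K E := IsScalarTower.of_algebraMap_eq fun _ => rfl
  haveI : Algebra.EssFiniteType k₀ K := hK
  have hE : Algebra.EssFiniteType k₀ E := Algebra.EssFiniteType.comp k₀ K E
  haveI : CharP E p := E.subtype.charP Subtype.val_injective p
  -- the level `X₀ ×_{K₀} E` is reduced and resolvable
  set ι₁ := Spec.map (CommRingCat.ofHom (Subfield.inclusion hK₀E)) with hι₁
  haveI : IsReduced (pullback f₀ ι₁) := isReduced_pullback_inclusion K₀ E hK₀E f₀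
  have hresE : Scheme.HasResolution (pullback f₀ ι₁) :=
    hasResolution_of_perfectRes_of_essFiniteType p H k₀ E hE _ (pullback.snd f₀ ι₁)
      inferInstance inferInstance inferInstance inferInstance
  -- `k/E` is separable algebraic, hence MacLane-separable; ascend
  haveI : Algebra.IsSeparable E k := Algebra.isSeparable_tower_top_of_isSeparable K E k
  have hML : ∀ u : Finset k, LinearIndepOn E _root_.id (↑u : Set k) →
      LinearIndepOn E (fun x : k => x ^ p) (↑u : Set k) :=
    fun u hu => linearIndepOn_pow_of_isSeparable E u hu
  haveI : ExpChar k p := ExpChar.prime (Fact.out : p.Prime)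
  have hk := hasResolution_pullback_subtype_of_linearIndepOn_pow p Fact.out E hML
    (pullback.snd f₀ ι₁) hresE
  -- transport along `(X₀ ×_{K₀} E) ×_E k ≅ X₀ ×_{K₀} k ≅ X`
  have hcomp : E.subtype.comp (Subfield.inclusion hK₀E) = K₀.subtype := RingHom.ext fun _ => rfl
  have ecomp : Spec.map (CommRingCat.ofHom E.subtype) ≫ ι₁ =
      Spec.map (CommRingCat.ofHom K₀.subtype) := by
    rw [hι₁, ← Spec.map_comp, ← CommRingCat.ofHom_comp, hcomp]
  exact (hk.of_iso (pullbackLeftPullbackSndIso f₀ ι₁ (Spec.map (CommRingCat.ofHom E.subtype)) ≪≫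
    pullback.congrHom rfl ecomp).hom).of_iso e.inv

/-- **The crux `DescentPerfectToAll` restricted to ground fields separable algebraic over a subfield
essentially of finite type over a perfect field, proved** (binder shape of stmt-0549 with the
hypotheses `PerfectField k₀`, `Algebra.EssFiniteType k₀ K`, `Algebra.IsSeparable K k` inserted;
the antecedent is used — over the perfect field `k₀`, for the spread-out models). [folklore] -/
theorem descentPerfectToAll_isSeparable_essFiniteType :
    ∀ p : ℕ, p.Prime → (∀ (k : Type) [Field k] [CharP k p] [PerfectField k] (X : Scheme.{0})
      (f : X ⟶ Spec (.of k)), IsSeparated f → LocallyOfFiniteType f → QuasiCompact f →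
        IsReduced X → Scheme.HasResolution X) →
    ∀ (k₀ : Type) [Field k₀] [PerfectField k₀] (k : Type) [Field k] [CharP k p] (K : Subfield k)
      [Algebra k₀ K], Algebra.EssFiniteType k₀ K → Algebra.IsSeparable K k →
      ∀ (X : Scheme.{0}) (f : X ⟶ Spec (.of k)),
        IsSeparated f → LocallyOfFiniteType f → QuasiCompact f → IsReduced X →
          Scheme.HasResolution X := by
  intro p hp H k₀ _ _ k _ _ K _ hK hsep X f _ _ _ _
  haveI : Fact p.Prime := ⟨hp⟩
  exact hasResolution_of_perfectRes_of_isSeparable_essFiniteType p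
    (fun κ _ _ _ Z h a b c d => H κ Z h a b c d) k₀ k K hK X f

end Summit.ResolutionOfSingularities.ResolutionOfSingularities.Theorems

end
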